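import Summits.AtomisticToContinuum.Crystallization.Theorems.ChartedZeroExcessLayeredLatticeLiouvilleTJ
import Summits.AtomisticToContinuum.Crystallization.Theorems.ChartedZeroExcessLayeredLatticeLiouvilleWindowPoincareGrid
import Summits.AtomisticToContinuum.Crystallization.Theorems.ChartedZeroExcessLayeredLatticeLiouvilleWindowPoincareTools

/-!
# (P) `WindowPoincareP 1` — the discrete Poincaré inequality on door-set windows (decomp-a2c hand-1 g17; critic rows 619 (a) / 620 (B) item 3)

Piece (P) of lens-2 g36's cut `(B2♭) ⟸ (G♯) ∧ (G♭) ∧ (P)` (`…LatticeLiouvilleTJ`, column `_16XH12`).  PROOF BY GRID COMPARISON (no canonical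
paths, no congestion counting): the cube → ball radial map `toBall` (sup-norm rescaling, `3`-Lipschitz, inverse `toCube` `8`-Lipschitz,
`…WindowPoincareMaps`) transplants the grid `{0,…,2m}³` of spacing `1/4` onto the ball of radius `m/4 ∈ [R − 29/20, R − 6/5]`; every grid image
has a window atom within the covering radius `6/5` of a clean configuration (`CleanHull.clean_exists_near`), which defines a grid function
`U = u ∘ rep ∘ toBall ∘ pos` whose nearest-neighbour increments are bounded by `τ ∘ rep ∘ toBall ∘ pos` (grid neighbours have representatives
within `3·(1/2) + 12/5 < 4`); the discrete cube Poincaré inequality (`…WindowPoincareGrid.grid_poincare`, pigeonhole form) gives the centre `t`;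
every window atom reaches the deep region `‖x‖ ≤ m/4` in at most two inward hops of length `< 37/10` and is then within `39/20` of the
representative of its rounded grid point; all multiplicities are bounded by the uniform packing bound of `δ`-separated sets in balls of radius `9`
(`Literature.Probability.Process.LocalConfig.exists_forall_encard_inter_le`) and by `78³` grid points per representative.
-/

noncomputable section

open scoped BigOperators
open MeasureTheory Set Metric Finset
open Summit.AtomisticToContinuum.Crystallization.Theorems.ChartedPlanarOrderRigidityDoor
open Summit.AtomisticToContinuum.Crystallization.Theorems.ChartedPlanarOrderDensityDichotomy (μS IsSep)
open Summit.AtomisticToContinuum.Crystallization.Theorems.ChartedPlanarOrderDoorLayered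
open Summit.AtomisticToContinuum.Crystallization.Theorems.ChartedPlanarOrderCleanScaleP
open Summit.AtomisticToContinuum.Crystallization.Theorems.ChartedZeroExcessLayeredLatticeLiouvilleWindowPoincare
open Literature.Geometry.DiscreteGeometry (IsTwoShellGoodSet)

namespace Summit.AtomisticToContinuum.Crystallization.Theorems.ChartedZeroExcessLayeredLatticeLiouville

/-- `(a + b + c + d)² ≤ 4 (a² + b² + c² + d²)`. [folklore] -/
private theorem add_four_sq_le (a b c d : ℝ) : (a + b + c + d) ^ 2 ≤ 4 * (a ^ 2 + b ^ 2 + c ^ 2 + d ^ 2) := by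
  nlinarith [sq_nonneg (a - b), sq_nonneg (a - c), sq_nonneg (a - d), sq_nonneg (b - c), sq_nonneg (b - d),
    sq_nonneg (c - d)]

/-! ## 2. The theorem -/

/-- ★★ **(P) `WindowPoincareP 1` — the discrete Poincaré inequality on door-set windows, PROVED** (grid comparison through the
cube ↔ ball radial maps; constant `C_P(δ) = 4(1 + 2C) + 9216·78³·C` with `C` the packing bound of `δ`-separated sets in balls of
radius `10`, floor `R₁ = 10`). [this file] -/
theorem windowPoincareP_one : WindowPoincareP 1 := by
  classical
  intro δ hδ
  obtain ⟨C, hC⟩ := Literature.Probability.Process.LocalConfig.exists_forall_encard_inter_le hδ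
    (isCompact_closedBall (0 : E3) 10)
  have hC0 : (0 : ℝ) ≤ C := Nat.cast_nonneg C
  refine ⟨4 * (1 + 2 * (C : ℝ)) + 9216 * 474552 * C, by linarith, 10, by norm_num, ?_⟩
  intro S hS R hR u τ hτ
  obtain ⟨h0S, hsep, hclean, -, -⟩ := hS
  have hsep' : ∀ x ∈ S, ∀ y ∈ S, x ≠ y → δ ≤ dist x y := hsep
  have hR10 : (10 : ℝ) ≤ R := hR
  -- covering radius `6/5`
  have hgood : ∀ q ∈ S, IsTwoShellGoodSet (1 / 16) (9 / 10) (103 / 100) S q :=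
    (isCleanP_μS_iff S).1 (isCleanP_mono (by norm_num) hclean)
  obtain ⟨-, -, -, hdir⟩ := ChartedPlanarOrderBarlowGluing.charts hgood
  have hcov : ∀ p : E3, ∃ y ∈ S, dist y p < 6 / 5 := fun p => CleanHull.clean_exists_near hdir h0S p
  choose rep hrepS hrep using hcov
  -- the window as a finite set
  have hWiff : ∀ p : E3, p ∈ atomsIn (μS S) 0 R ↔ p ∈ S ∧ ‖p‖ ≤ R := by
    intro p
    simp only [atomsIn, Set.mem_setOf_eq, dist_zero_right]
    rw [Literature.Probability.Process.count_restrict_singleton_ne_zero_iff]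
  have hWfin : (atomsIn (μS S) 0 R).Finite := by
    refine (Literature.Probability.Process.LocalConfig.finite_inter_of_separated hδ hsep'
      (isCompact_closedBall (0 : E3) R)).subset ?_
    intro p hp
    obtain ⟨hpS, hpR⟩ := (hWiff p).1 hp
    exact ⟨mem_closedBall.2 (by rwa [dist_zero_right]), hpS⟩
  set Wf : Finset E3 := hWfin.toFinset with hWf
  have hmemWf : ∀ p, p ∈ Wf ↔ p ∈ S ∧ ‖p‖ ≤ R := fun p => by rw [hWf, Set.Finite.mem_toFinset, hWiff]
  -- the increment bound in norm form, and `τ ≥ 0` on the window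
  have hinc : ∀ x p : E3, x ∈ S → ‖x‖ ≤ R → p ∈ S → ‖p‖ ≤ R → dist p x ≤ 4 → ‖u p - u x‖ ≤ τ x := by
    intro x p hxS hxR hpS hpR hd
    rw [← dist_eq_norm]; exact hτ x ((hWiff x).2 ⟨hxS, hxR⟩) p ((hWiff p).2 ⟨hpS, hpR⟩) hd
  have hτ0 : ∀ x, x ∈ S → ‖x‖ ≤ R → 0 ≤ τ x := by
    intro x hxS hxR
    have := hinc x x hxS hxR hxS hxR (by rw [dist_self]; norm_num)
    exact (norm_nonneg _).trans this
  -- grid size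
  set m : ℕ := ⌊4 * (R - 6 / 5)⌋₊ with hmdef
  set n : ℕ := 2 * m + 1 with hndef
  have hm_le : (m : ℝ) / 4 ≤ R - 6 / 5 := by
    have : (m : ℝ) ≤ 4 * (R - 6 / 5) := Nat.floor_le (by linarith)
    linarith
  have hm_ge : R - 29 / 20 ≤ (m : ℝ) / 4 := by
    have : 4 * (R - 6 / 5) < (m : ℝ) + 1 := Nat.lt_floor_add_one _
    linarith
  have hn_le : (n : ℝ) ≤ 8 * R := by rw [hndef]; push_cast; linarith
  have hn_pos : 0 < n := by omega
  -- grid anchors `A i j k = rep (toBall (gridPos m i j k))`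
  obtain ⟨A, hAdef⟩ : ∃ A : ℕ → ℕ → ℕ → E3, ∀ i j k, A i j k = rep (toBall (gridPos m i j k)) :=
    ⟨fun i j k => rep (toBall (gridPos m i j k)), fun _ _ _ => rfl⟩
  have hA_S : ∀ i j k, A i j k ∈ S := fun i j k => by rw [hAdef]; exact hrepS _
  have hA_near : ∀ i j k, dist (A i j k) (toBall (gridPos m i j k)) < 6 / 5 := fun i j k => by
    rw [hAdef]; exact hrep _
  have hA_R : ∀ i j k, i < n → j < n → k < n → ‖A i j k‖ ≤ R := by
    intro i j k hi hj hk
    have h1 : ‖toBall (gridPos m i j k)‖ ≤ (m : ℝ) / 4 := by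
      rw [norm_toBall]; exact linf_gridPos_le hi hj hk
    have := norm_le_of_dist_le h1 (hA_near i j k).le
    linarith
  -- the grid function and its increment profile
  set U : ℕ → ℕ → ℕ → E3 := fun i j k => u (A i j k) with hUdef
  set Θ : ℕ → ℕ → ℕ → ℝ := fun i j k => max (τ (A i j k)) 0 with hΘdef
  have hΘ0 : ∀ i j k, 0 ≤ Θ i j k := fun _ _ _ => le_max_right _ _
  have hnb : ∀ i j k i' j' k', i < n → j < n → k < n → i' < n → j' < n → k' < n →
      ‖gridPos m i' j' k' - gridPos m i j k‖ ≤ 1 / 2 → ‖U i' j' k' - U i j k‖ ≤ Θ i j k := by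
    intro i j k i' j' k' hi hj hk hi' hj' hk' hg
    have hd : dist (A i' j' k') (A i j k) ≤ 4 := by
      calc dist (A i' j' k') (A i j k)
          ≤ dist (A i' j' k') (toBall (gridPos m i' j' k')) +
              dist (toBall (gridPos m i' j' k')) (toBall (gridPos m i j k)) +
              dist (toBall (gridPos m i j k)) (A i j k) := dist_triangle4 _ _ _ _
        _ ≤ 6 / 5 + 3 * (1 / 2) + 6 / 5 := by
            gcongr
            · exact (hA_near _ _ _).le
            · rw [dist_eq_norm]; exact (norm_toBall_sub_le _ _).trans (by linarith)
            · rw [dist_comm]; exact (hA_near _ _ _).le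
        _ ≤ 4 := by norm_num
    exact (hinc _ _ (hA_S i j k) (hA_R i j k hi hj hk) (hA_S _ _ _) (hA_R _ _ _ hi' hj' hk') hd).trans
      (le_max_left _ _)
  obtain ⟨a', ha', b', hb', c', hc', hgrid⟩ := grid_poincare n hn_pos U Θ hΘ0
    (fun i j k hi hj hk => hnb i j k (i + 1) j k (by omega) hj hk hi hj hk (norm_gridPos_succ₁ m i j k))
    (fun i j k hi hj hk => hnb i j k i (j + 1) k hi (by omega) hk hi hj hk (norm_gridPos_succ₂ m i j k))
    (fun i j k hi hj hk => hnb i j k i j (k + 1) hi hj (by omega) hi hj hk (norm_gridPos_succ₃ m i j k))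
  rw [Finset.mem_range] at ha' hb' hc'
  refine ⟨U a' b' c', ?_⟩
  rw [finsum_mem_eq_finite_toFinset_sum _ hWfin, finsum_mem_eq_finite_toFinset_sum _ hWfin]
  set t : E3 := U a' b' c' with htdef
  -- inward hops
  obtain ⟨hop, hhopdef⟩ : ∃ hop : E3 → E3, ∀ p, hop p =
      if ‖p‖ ≤ (m : ℝ) / 4 then p else rep ((1 - 5 / (2 * ‖p‖)) • p) :=
    ⟨fun p => if ‖p‖ ≤ (m : ℝ) / 4 then p else rep ((1 - 5 / (2 * ‖p‖)) • p), fun _ => rfl⟩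
  have hhop : ∀ p, p ∈ S → ‖p‖ ≤ R → hop p ∈ S ∧ ‖hop p‖ ≤ R ∧ dist (hop p) p < 37 / 10 ∧
      (‖p‖ ≤ (m : ℝ) / 4 → hop p = p) ∧ ((m : ℝ) / 4 < ‖p‖ → ‖hop p‖ ≤ ‖p‖ - 13 / 10) := by
    intro p hpS hpR
    by_cases hpm : ‖p‖ ≤ (m : ℝ) / 4
    · rw [hhopdef, if_pos hpm]
      exact ⟨hpS, hpR, by rw [dist_self]; norm_num, fun _ => rfl, fun h => absurd hpm (not_le.2 h)⟩
    · rw [hhopdef, if_neg hpm]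
      have hp0 : (5 : ℝ) / 2 < ‖p‖ := by have := not_le.1 hpm; linarith
      set z : E3 := (1 - 5 / (2 * ‖p‖)) • p with hz
      have hcoef : 0 ≤ 1 - 5 / (2 * ‖p‖) := by
        rw [sub_nonneg, div_le_one (by linarith)]; linarith
      have hpn : ‖p‖ ≠ 0 := by positivity
      have hz_norm : ‖z‖ = ‖p‖ - 5 / 2 := by
        rw [hz, norm_smul, Real.norm_eq_abs, abs_of_nonneg hcoef]
        have e : (1 - 5 / (2 * ‖p‖)) * ‖p‖ = ‖p‖ - 5 / 2 * (‖p‖ / ‖p‖) := by ring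
        rw [e, div_self hpn, mul_one]
      have hz_dist : dist z p = 5 / 2 := by
        have e : z - p = -((5 / (2 * ‖p‖)) • p) := by rw [hz, sub_smul, one_smul]; abel
        rw [dist_eq_norm, e, norm_neg, norm_smul, Real.norm_eq_abs, abs_of_nonneg (by positivity)]
        have e' : 5 / (2 * ‖p‖) * ‖p‖ = 5 / 2 * (‖p‖ / ‖p‖) := by ring
        rw [e', div_self hpn, mul_one]
      have hrz : ‖rep z‖ ≤ ‖p‖ - 5 / 2 + 6 / 5 := norm_le_of_dist_le hz_norm.le (hrep z).le
      refine ⟨hrepS z, by linarith, ?_, fun h => absurd h hpm, fun _ => by linarith⟩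
      calc dist (rep z) p ≤ dist (rep z) z + dist z p := dist_triangle _ _ _
        _ < 6 / 5 + 5 / 2 := by rw [hz_dist]; linarith [hrep z]
        _ = 37 / 10 := by norm_num
  have hdeep : ∀ x, x ∈ S → ‖x‖ ≤ R → ‖hop (hop x)‖ ≤ (m : ℝ) / 4 := by
    intro x hxS hxR
    obtain ⟨h1S, h1R, -, h1fix, h1dec⟩ := hhop x hxS hxR
    obtain ⟨-, -, -, h2fix, h2dec⟩ := hhop (hop x) h1S h1R
    by_cases hx : ‖x‖ ≤ (m : ℝ) / 4
    · rw [h1fix hx, h1fix hx]; exact hx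
    · have hx1 := h1dec (not_le.1 hx)
      by_cases hx2 : ‖hop x‖ ≤ (m : ℝ) / 4
      · rw [h2fix hx2]; exact hx2
      · have := h2dec (not_le.1 hx2)
        linarith
  -- grid rounding of deep points
  set gi : E3 → ℕ := fun p => roundIdx m (toCube p 0) with hgi
  set gj : E3 → ℕ := fun p => roundIdx m (toCube p 1) with hgj
  set gk : E3 → ℕ := fun p => roundIdx m (toCube p 2) with hgk
  have hanchor : ∀ p : E3, ‖p‖ ≤ (m : ℝ) / 4 →
      gi p < n ∧ gj p < n ∧ gk p < n ∧ dist (A (gi p) (gj p) (gk p)) p < 39 / 20 := by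
    intro p hpm
    have hq : linf (toCube p) ≤ (m : ℝ) / 4 := by rw [linf_toCube]; exact hpm
    obtain ⟨h0, h1, h2, hnear⟩ := exists_gridPos_near hq
    refine ⟨h0, h1, h2, ?_⟩
    have hb : ‖toBall (gridPos m (gi p) (gj p) (gk p)) - p‖ ≤ 3 / 4 := by
      have := norm_toBall_sub_le (gridPos m (gi p) (gj p) (gk p)) (toCube p)
      rw [toBall_toCube] at this
      linarith
    calc dist (A (gi p) (gj p) (gk p)) p
        ≤ dist (A (gi p) (gj p) (gk p)) (toBall (gridPos m (gi p) (gj p) (gk p))) +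
            dist (toBall (gridPos m (gi p) (gj p) (gk p))) p := dist_triangle _ _ _
      _ < 6 / 5 + 3 / 4 := add_lt_add_of_lt_of_le (hA_near _ _ _) (by rwa [dist_eq_norm])
      _ = 39 / 20 := by norm_num
  -- the per-atom chain bound
  have hWfS : ∀ x ∈ Wf, x ∈ S ∧ ‖x‖ ≤ R := fun x hx => (hmemWf x).1 hx
  have hchain : ∀ x ∈ Wf, ‖u x - t‖ ^ 2 ≤
      4 * (τ x ^ 2 + τ (hop x) ^ 2 + τ (hop (hop x)) ^ 2 +
        ‖U (gi (hop (hop x))) (gj (hop (hop x))) (gk (hop (hop x))) - t‖ ^ 2) := by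
    intro x hx
    obtain ⟨hxS, hxR⟩ := hWfS x hx
    obtain ⟨h1S, h1R, h1d, -, -⟩ := hhop x hxS hxR
    obtain ⟨h2S, h2R, h2d, -, -⟩ := hhop (hop x) h1S h1R
    have hdp := hdeep x hxS hxR
    obtain ⟨gi_lt, gj_lt, gk_lt, hnear⟩ := hanchor (hop (hop x)) hdp
    set y := hop (hop x) with hy
    have d1 : ‖u (hop x) - u x‖ ≤ τ x := hinc x (hop x) hxS hxR h1S h1R (by linarith)
    have d2 : ‖u y - u (hop x)‖ ≤ τ (hop x) := hinc (hop x) y h1S h1R h2S h2R (by linarith)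
    have d3 : ‖U (gi y) (gj y) (gk y) - u y‖ ≤ τ y :=
      hinc y _ h2S h2R (hA_S _ _ _) (hA_R _ _ _ gi_lt gj_lt gk_lt) (by linarith [hnear])
    have htri : ‖u x - t‖ ≤ τ x + τ (hop x) + τ y + ‖U (gi y) (gj y) (gk y) - t‖ := by
      have e1 : dist (u x) (u (hop x)) ≤ τ x := by rw [dist_comm, dist_eq_norm]; exact d1
      have e2 : dist (u (hop x)) (u y) ≤ τ (hop x) := by rw [dist_comm, dist_eq_norm]; exact d2
      have e3 : dist (u y) (U (gi y) (gj y) (gk y)) ≤ τ y := by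
        rw [dist_comm, dist_eq_norm]; exact d3
      have e4 : dist (U (gi y) (gj y) (gk y)) t = ‖U (gi y) (gj y) (gk y) - t‖ := dist_eq_norm _ _
      rw [← dist_eq_norm]
      calc dist (u x) t ≤ dist (u x) (U (gi y) (gj y) (gk y)) + dist (U (gi y) (gj y) (gk y)) t := dist_triangle _ _ _
        _ ≤ (dist (u x) (u (hop x)) + dist (u (hop x)) (u y) + dist (u y) (U (gi y) (gj y) (gk y))) +
            dist (U (gi y) (gj y) (gk y)) t := add_le_add (dist_triangle4 _ _ _ _) le_rfl
        _ ≤ (τ x + τ (hop x) + τ y) + ‖U (gi y) (gj y) (gk y) - t‖ := by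
          rw [e4]; exact add_le_add (add_le_add (add_le_add e1 e2) e3) le_rfl
    have h0 : 0 ≤ τ x + τ (hop x) + τ y + ‖U (gi y) (gj y) (gk y) - t‖ := by
      have := hτ0 x hxS hxR; have := hτ0 _ h1S h1R; have := hτ0 _ h2S h2R; positivity
    calc ‖u x - t‖ ^ 2 ≤ (τ x + τ (hop x) + τ y + ‖U (gi y) (gj y) (gk y) - t‖) ^ 2 :=
          pow_le_pow_left₀ (norm_nonneg _) htri 2
      _ ≤ _ := add_four_sq_le _ _ _ _
  -- the total profile budget
  set T := ∑ x ∈ Wf, τ x ^ 2 with hT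
  have hT0 : 0 ≤ T := Finset.sum_nonneg fun x _ => sq_nonneg _
  have hhopW : ∀ x ∈ Wf, hop x ∈ Wf := fun x hx => by
    obtain ⟨hxS, hxR⟩ := hWfS x hx
    obtain ⟨h1, h2, -⟩ := hhop x hxS hxR
    exact (hmemWf _).2 ⟨h1, h2⟩
  -- (i) one hop
  have S1 : ∑ x ∈ Wf, τ (hop x) ^ 2 ≤ C * T := by
    refine sum_comp_le_of_fiber_le Wf Wf hop (fun w => τ w ^ 2) C hhopW (fun _ _ => sq_nonneg _) ?_
    intro w _
    refine card_le_of_sep_ball hC hsep' w _ ?_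
    intro x hx
    rw [Finset.mem_filter] at hx
    obtain ⟨hxW, hxw⟩ := hx
    obtain ⟨hxS, hxR⟩ := hWfS x hxW
    obtain ⟨-, -, hd, -⟩ := hhop x hxS hxR
    refine ⟨hxS, ?_⟩
    rw [← hxw, dist_comm]; linarith
  -- (ii) two hops
  have S2 : ∑ x ∈ Wf, τ (hop (hop x)) ^ 2 ≤ C * T := by
    refine sum_comp_le_of_fiber_le Wf Wf (fun x => hop (hop x)) (fun w => τ w ^ 2) C
      (fun x hx => hhopW _ (hhopW x hx)) (fun _ _ => sq_nonneg _) ?_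
    intro w _
    refine card_le_of_sep_ball hC hsep' w _ ?_
    intro x hx
    rw [Finset.mem_filter] at hx
    obtain ⟨hxW, hxw⟩ := hx
    obtain ⟨hxS, hxR⟩ := hWfS x hxW
    obtain ⟨h1S, h1R, hd1, -⟩ := hhop x hxS hxR
    obtain ⟨-, -, hd2, -⟩ := hhop (hop x) h1S h1R
    refine ⟨hxS, ?_⟩
    rw [← hxw]
    calc dist x (hop (hop x)) ≤ dist x (hop x) + dist (hop x) (hop (hop x)) := dist_triangle _ _ _
      _ ≤ 10 := by rw [dist_comm x (hop x), dist_comm (hop x) (hop (hop x))]; linarith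
  -- (iii) grid attachment
  set B : Finset (ℕ × ℕ × ℕ) := Finset.range n ×ˢ (Finset.range n ×ˢ Finset.range n) with hB
  have hBmem : ∀ ijk : ℕ × ℕ × ℕ, ijk ∈ B ↔ ijk.1 < n ∧ ijk.2.1 < n ∧ ijk.2.2 < n := by
    intro ijk; simp only [hB, Finset.mem_product, Finset.mem_range]
  have S3 : ∑ x ∈ Wf, ‖U (gi (hop (hop x))) (gj (hop (hop x))) (gk (hop (hop x))) - t‖ ^ 2 ≤
      C * ∑ ijk ∈ B, ‖U ijk.1 ijk.2.1 ijk.2.2 - t‖ ^ 2 := by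
    have := sum_comp_le_of_fiber_le Wf B (fun x => (gi (hop (hop x)), gj (hop (hop x)), gk (hop (hop x))))
      (fun ijk => ‖U ijk.1 ijk.2.1 ijk.2.2 - t‖ ^ 2) C ?_ (fun _ _ => sq_nonneg _) ?_
    · exact this
    · intro x hx
      obtain ⟨hxS, hxR⟩ := hWfS x hx
      obtain ⟨g1, g2, g3, -⟩ := hanchor (hop (hop x)) (hdeep x hxS hxR)
      exact (hBmem _).2 ⟨g1, g2, g3⟩
    · intro ijk _
      refine card_le_of_sep_ball hC hsep' (A ijk.1 ijk.2.1 ijk.2.2) _ ?_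
      intro x hx
      rw [Finset.mem_filter] at hx
      obtain ⟨hxW, hxg⟩ := hx
      obtain ⟨hxS, hxR⟩ := hWfS x hxW
      refine ⟨hxS, ?_⟩
      obtain ⟨h1S, h1R, hd1, -⟩ := hhop x hxS hxR
      obtain ⟨-, -, hd2, -⟩ := hhop (hop x) h1S h1R
      obtain ⟨-, -, -, hnear⟩ := hanchor (hop (hop x)) (hdeep x hxS hxR)
      rw [← hxg]
      calc dist x (A (gi (hop (hop x))) (gj (hop (hop x))) (gk (hop (hop x))))
          ≤ dist x (hop x) + dist (hop x) (hop (hop x)) +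
              dist (hop (hop x)) (A (gi (hop (hop x))) (gj (hop (hop x))) (gk (hop (hop x)))) := dist_triangle4 _ _ _ _
        _ ≤ 10 := by
            rw [dist_comm x (hop x), dist_comm (hop x) (hop (hop x)),
              dist_comm (hop (hop x)) (A (gi (hop (hop x))) (gj (hop (hop x))) (gk (hop (hop x))))]
            linarith
  have S4 : ∑ ijk ∈ B, ‖U ijk.1 ijk.2.1 ijk.2.2 - t‖ ^ 2 =
      ∑ a ∈ Finset.range n, ∑ b ∈ Finset.range n, ∑ c ∈ Finset.range n, ‖U a b c - t‖ ^ 2 := by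
    rw [hB, Finset.sum_product]
    refine Finset.sum_congr rfl fun a _ => ?_
    rw [Finset.sum_product]
  -- (iv) grid multiplicity of the representatives
  have S5 : ∑ a ∈ Finset.range n, ∑ b ∈ Finset.range n, ∑ c ∈ Finset.range n, Θ a b c ^ 2 ≤ 474552 * T := by
    have e : ∑ a ∈ Finset.range n, ∑ b ∈ Finset.range n, ∑ c ∈ Finset.range n, Θ a b c ^ 2 =
        ∑ ijk ∈ B, τ (A ijk.1 ijk.2.1 ijk.2.2) ^ 2 := by
      rw [hB, Finset.sum_product]
      refine Finset.sum_congr rfl fun a ha => ?_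
      rw [Finset.sum_product]
      refine Finset.sum_congr rfl fun b hb => Finset.sum_congr rfl fun c hc => ?_
      rw [Finset.mem_range] at ha hb hc
      rw [hΘdef]
      simp only
      rw [max_eq_left (hτ0 _ (hA_S a b c) (hA_R a b c ha hb hc))]
    rw [e]
    refine sum_comp_le_of_fiber_le B Wf (fun ijk => A ijk.1 ijk.2.1 ijk.2.2) (fun w => τ w ^ 2) 474552 ?_
      (fun _ _ => sq_nonneg _) ?_
    · intro ijk hijk
      rw [hBmem] at hijk
      exact (hmemWf _).2 ⟨hA_S _ _ _, hA_R _ _ _ hijk.1 hijk.2.1 hijk.2.2⟩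
    · intro w _
      set q : E3 := toCube w with hq
      set F := B.filter (fun ijk => A ijk.1 ijk.2.1 ijk.2.2 = w) with hF
      have key : ∀ ijk ∈ F, ‖q - gridPos m ijk.1 ijk.2.1 ijk.2.2‖ ≤ 48 / 5 := by
        intro ijk hijk
        rw [hF, Finset.mem_filter] at hijk
        have hd : dist w (toBall (gridPos m ijk.1 ijk.2.1 ijk.2.2)) < 6 / 5 := by
          rw [← hijk.2]; exact hA_near _ _ _
        have h8 := norm_toCube_sub_le w (toBall (gridPos m ijk.1 ijk.2.1 ijk.2.2))
        rw [toCube_toBall, ← dist_eq_norm w] at h8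
        rw [hq]
        linarith
      set I : Finset ℕ := (Finset.range n).filter
        (fun i => 4 * q 0 + m - 385 / 10 < i ∧ (i : ℝ) < 4 * q 0 + m - 385 / 10 + 77) with hI
      set J : Finset ℕ := (Finset.range n).filter
        (fun i => 4 * q 1 + m - 385 / 10 < i ∧ (i : ℝ) < 4 * q 1 + m - 385 / 10 + 77) with hJ
      set K : Finset ℕ := (Finset.range n).filter
        (fun i => 4 * q 2 + m - 385 / 10 < i ∧ (i : ℝ) < 4 * q 2 + m - 385 / 10 + 77) with hK
      have hsub : F ⊆ I ×ˢ (J ×ˢ K) := by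
        intro ijk hijk
        have hk := key ijk hijk
        have hmemB : ijk ∈ B := (Finset.mem_filter.1 (hF ▸ hijk)).1
        rw [hBmem] at hmemB
        have hc : ∀ c : Fin 3, |q c - (gridPos m ijk.1 ijk.2.1 ijk.2.2) c| ≤ 48 / 5 := fun c => by
          have := (abs_apply_le_linf (q - gridPos m ijk.1 ijk.2.1 ijk.2.2) c).trans ((linf_le_norm _).trans hk)
          simpa only [PiLp.sub_apply] using this
        have h0 := hc 0
        have h1 := hc 1
        have h2 := hc 2
        simp only [gridPos, mk3_apply_zero, mk3_apply_one, mk3_apply_two] at h0 h1 h2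
        simp only [hI, hJ, hK, Finset.mem_product, Finset.mem_filter, Finset.mem_range]
        exact ⟨⟨hmemB.1, idx_window rfl h0⟩, ⟨hmemB.2.1, idx_window rfl h1⟩, ⟨hmemB.2.2, idx_window rfl h2⟩⟩
      have hIc : I.card ≤ 78 := card_le_of_window I _ fun i hi => (Finset.mem_filter.1 hi).2
      have hJc : J.card ≤ 78 := card_le_of_window J _ fun i hi => (Finset.mem_filter.1 hi).2
      have hKc : K.card ≤ 78 := card_le_of_window K _ fun i hi => (Finset.mem_filter.1 hi).2
      calc F.card ≤ (I ×ˢ (J ×ˢ K)).card := Finset.card_le_card hsub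
        _ = I.card * (J.card * K.card) := by rw [Finset.card_product, Finset.card_product]
        _ ≤ 78 * (78 * 78) := Nat.mul_le_mul hIc (Nat.mul_le_mul hJc hKc)
        _ = 474552 := by norm_num
  -- assembly
  have S3' : ∑ x ∈ Wf, ‖U (gi (hop (hop x))) (gj (hop (hop x))) (gk (hop (hop x))) - t‖ ^ 2 ≤
      C * (36 * (n : ℝ) ^ 2 * (474552 * T)) := by
    calc ∑ x ∈ Wf, ‖U (gi (hop (hop x))) (gj (hop (hop x))) (gk (hop (hop x))) - t‖ ^ 2
        ≤ C * ∑ ijk ∈ B, ‖U ijk.1 ijk.2.1 ijk.2.2 - t‖ ^ 2 := S3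
      _ = C * ∑ a ∈ Finset.range n, ∑ b ∈ Finset.range n, ∑ c ∈ Finset.range n, ‖U a b c - t‖ ^ 2 := by rw [S4]
      _ ≤ C * (36 * (n : ℝ) ^ 2 * ∑ a ∈ Finset.range n, ∑ b ∈ Finset.range n, ∑ c ∈ Finset.range n,
            Θ a b c ^ 2) := by gcongr
      _ ≤ C * (36 * (n : ℝ) ^ 2 * (474552 * T)) := by gcongr
  have hn2 : (n : ℝ) ^ 2 ≤ 64 * R ^ 2 := by
    have hn0 : (0 : ℝ) ≤ n := Nat.cast_nonneg n
    nlinarith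
  have hR2 : 1 ≤ R ^ 2 := by nlinarith
  have k1 : (4 + 8 * (C : ℝ)) * T ≤ (4 + 8 * (C : ℝ)) * (R ^ 2 * T) :=
    mul_le_mul_of_nonneg_left (le_mul_of_one_le_left hT0 hR2) (by positivity)
  have k2 : (C : ℝ) * (36 * (n : ℝ) ^ 2 * (474552 * T)) ≤ C * (36 * (64 * R ^ 2) * (474552 * T)) := by gcongr
  calc ∑ x ∈ Wf, ‖u x - t‖ ^ 2
      ≤ ∑ x ∈ Wf, 4 * (τ x ^ 2 + τ (hop x) ^ 2 + τ (hop (hop x)) ^ 2 +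
          ‖U (gi (hop (hop x))) (gj (hop (hop x))) (gk (hop (hop x))) - t‖ ^ 2) := Finset.sum_le_sum hchain
    _ = 4 * (T + ∑ x ∈ Wf, τ (hop x) ^ 2 + ∑ x ∈ Wf, τ (hop (hop x)) ^ 2 +
          ∑ x ∈ Wf, ‖U (gi (hop (hop x))) (gj (hop (hop x))) (gk (hop (hop x))) - t‖ ^ 2) := by
        rw [← Finset.mul_sum, Finset.sum_add_distrib, Finset.sum_add_distrib, Finset.sum_add_distrib]
    _ ≤ 4 * (T + C * T + C * T + C * (36 * (n : ℝ) ^ 2 * (474552 * T))) := by gcongr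
    _ ≤ (4 * (1 + 2 * (C : ℝ)) + 9216 * 474552 * C) * R ^ 2 * T := by linarith


end Summit.AtomisticToContinuum.Crystallization.Theorems.ChartedZeroExcessLayeredLatticeLiouville
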